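import Summits.ResolutionOfSingularities.ResolutionOfSingularities.Theorems.MarkedTransferCampaignW46ThreefoldsGammaFreeGlobal
import Literature.AlgebraicGeometry.Resolution.ExceptionalDivisorRegularGlobal
import Literature.AlgebraicGeometry.Resolution.ExceptionalDivisorIrreducible
import Literature.AlgebraicGeometry.Resolution.ExceptionalDivisorGenericOrder
import Literature.AlgebraicGeometry.Resolution.GenericPointStalkData
import Literature.AlgebraicGeometry.Resolution.BlowupChartMembership
import Literature.AlgebraicGeometry.Resolution.MonomialOrderReductionUnit
import Literature.AlgebraicGeometry.Resolution.BlowupOffCentre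
import Literature.AlgebraicGeometry.Resolution.PointCentrePermissible
import Literature.AlgebraicGeometry.Resolution.DivisorialPart
import Literature.AlgebraicGeometry.Resolution.DivisorialPartLemmas
import Literature.AlgebraicGeometry.Resolution.OrderSemicontinuity
import Literature.AlgebraicGeometry.Resolution.EmbeddedCurvePointBlowups
import Mathlib.RingTheory.DiscreteValuationRing.TFAE
import HarnessLib

/-!
# [OURS · L1 W4.6 rung (ii), dimension ladder] PRIME DIVISORS OF THE CONTROLLED TRANSFORM UNDER THE BLOWING UP OF A CLOSED
# POINT (brick B8a of rung (ii-2) `GammaFreeGlobalOrderReductionDimLE p 2`; any dimension)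

Cell res-hironaka, LADDER-RESOLUTION rung L (D-0089), slot W4.6 «restricted-regime rungs of the typed Th. 16.6 procedure»,
rung (ii) (dimension ladder, res-L1-type-o1 p496755); seat res-D-pv-049 AS res-L1-s46-pv-11 (holder of rung (ii-2), res-plan-2
D→L MAP v1.6 (3); architecture v2 on STATUS 2026-08-27T05:4xZ). Host route MarkedTransfer, host item
`HypersurfaceOrderReductionDimLeThree` (stmt-ResolutionOfSingularities-16156); proposed `--kind proof --supports` it `--as helper`.
Everything here is OURS scheme theory over the tree's blow-up library; nothing of H. Hironaka's manuscript [Hironaka2017] is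
asserted. AI-written; AI review is weaker than expert review.

## What is proved — the bookkeeping of ONE step of the surface loop at the level of prime divisors and generic orders

Setting: `X` regular integral locally Noetherian, `x` a closed point with `{x} ≠ X`, `π : X′ → X` a blowing up along the reduced
point `𝓘_{x}` (universal property `IsBlowup`), `J` an ideal sheaf, `m : ℕ`, `J′ := (J𝒪_{X′} : 𝓘_E^m)` the controlled transform.

* `interior_singleton_eq_empty`, `isIrreducible_preimage_singleton_of_isClosed`, `exists_isGenericPoint_exc` — the exceptional
  locus `E = π⁻¹{x}` is an irreducible closed set with a generic point `η_E` (Liu 8.1.19 (b), tree `IsBlowup.isIrreducible_preimage_of_isRegular`).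
* `primeDivisorIdeal_excGen_eq_comap` — `𝓘_{cl η_E} = 𝓘_{x}·𝒪_{X′}` (the exceptional ideal is the REDUCED ideal of `E`, tree
  `IsBlowup.comap_vanishingIdeal_eq_vanishingIdeal_preimage`); `isRegular_subscheme_primeDivisorIdeal_excGen` — `E` with its
  reduced structure is a REGULAR scheme (tree `IsBlowup.isRegular_subscheme_comap`).
* `coheight_excGen` — `η_E` has codimension one (its local ring is a Noetherian local domain with principal non-zero maximal
  ideal `(t)`, `t` a local equation of the Cartier divisor `E`, hence a DVR).
* `idealOrder_controlledTransform_excGen` — `ord_{η_E} J′ = ord_x J − m` (tree, Cossart–Piltant 2008 (10)–(11)).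
* `mem_divisorialPoints_controlledTransform_iff_of_ne` — OFF the exceptional locus nothing changes: for `π ζ′ ≠ x`,
  `ζ′ ∈ divisorialPoints J′ ↔ π ζ′ ∈ divisorialPoints J` and `ord_{ζ′} J′ = ord_{π ζ′} J` (local rings and stalks agree).
* `eq_excGen_of_mem_divisorialPoints`, `excGen_mem_divisorialPoints_iff` — ON the exceptional locus the only possible prime
  divisor of `J′` is `η_E`, and it is one iff `m < ord_x J`.
* `exists_eq_of_ne_centre`, `eq_of_apply_eq_of_ne_centre` — `π` is a bijection over `X ∖ {x}` (tree `IsBlowup.isIso_compl`).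

So the prime divisors of `J′` are the strict transforms of those of `J` (same generic orders) together with `E` (generic order
`ord_x J − m`, present iff `> 0`): the input the d = 2 termination measure `(Σδ, Σ(i−1), Σ(k−2)⁺)` is computed from.

## Sources

* Q. Liu, *Algebraic Geometry and Arithmetic Curves* (2002), Thm. 8.1.19. [Liu2002]
* V. Cossart, O. Piltant, J. Algebra 320 (2008), proof of Prop. 4.2, (10)–(11). [CossartPiltant2008]
* The Stacks Project, Tags 02OS (blow-up is an iso off the centre), 0BE1. [StacksProject]
* H. Hironaka, ms. 2017-03-23, Def. 2.1 p.5, Rem. 7.9 (3) p.37 — scope only, under adjudication, not cited as fact. [Hironaka2017]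
-/

noncomputable section

set_option linter.dupNamespace false -- mandated namespace of this single-conjunct summit

open CategoryTheory AlgebraicGeometry TopologicalSpace IsLocalRing

namespace Summit.ResolutionOfSingularities.ResolutionOfSingularities.Theorems

namespace CampaignW46

open Literature.AlgebraicGeometry.Resolution
open Scheme.IdealSheafData
open Literature.AlgebraicGeometry.Hironaka2017

universe u

section PointBlowup

variable {X X' : Scheme.{u}}

/-- A closed point different from the whole (irreducible) scheme has empty interior: a non-empty open subset of an irreducible
space is dense. [folklore] -/
theorem interior_singleton_eq_empty [IrreducibleSpace X] {x : X} (hx : IsClosed ({x} : Set X))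
    (hxne : ({x} : Set X) ≠ Set.univ) : interior ({x} : Set X) = ∅ := by
  by_contra hne
  apply hxne
  have hne' : (interior ({x} : Set X)).Nonempty := Set.nonempty_iff_ne_empty.mpr hne
  have hdense : Dense (interior ({x} : Set X)) := isOpen_interior.dense hne'
  have h1 : closure (interior ({x} : Set X)) ⊆ {x} :=
    (closure_mono interior_subset).trans hx.closure_eq.subset
  exact Set.eq_univ_of_univ_subset (hdense.closure_eq ▸ h1)

variable [IsLocallyNoetherian X] (hX : Scheme.IsRegular X) {x : X} (hx : IsClosed ({x} : Set X))
  (hxne : ({x} : Set X) ≠ Set.univ) {π : X' ⟶ X} (hπ : IsBlowup π (vanishingIdeal ⟨{x}, hx⟩))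

include hX hxne hπ in
/-- **The exceptional locus `E = π⁻¹{x}` of the blowing up of a regular integral scheme at a closed point is irreducible**
(it is `ℙ^{d−1}_{κ(x)}`; tree `IsBlowup.isIrreducible_preimage_of_isRegular` for the regular centre `{x}`).
[cite: Liu2002, Thm. 8.1.19 (b)] -/
theorem isIrreducible_preimage_singleton_of_isClosed [IrreducibleSpace X] : IsIrreducible (π ⁻¹' ({x} : Set X)) :=
  hπ.isIrreducible_preimage_of_isRegular hX (isRegular_subscheme_vanishingIdeal_singleton hx)
    isIrreducible_singleton (interior_singleton_eq_empty hx hxne)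

include hX hxne hπ in
/-- The exceptional locus has a generic point `η_E`. [cite: Liu2002, Thm. 8.1.19 (b)] -/
theorem exists_isGenericPoint_exc [IrreducibleSpace X] : ∃ η : X', IsGenericPoint η (π ⁻¹' ({x} : Set X)) :=
  QuasiSober.sober (isIrreducible_preimage_singleton_of_isClosed hX hx hxne hπ) (hx.preimage π.continuous)

include hX hπ in
/-- **The exceptional ideal is the reduced ideal of `E`**: `𝓘_{x}·𝒪_{X′} = 𝓘_{π⁻¹{x}}` (tree, Hironaka Rem. 7.9 (3) scope only /
Liu 8.1.19 (b)). [cite: Liu2002, Thm. 8.1.19 (b)] -/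
theorem comap_vanishingIdeal_singleton_eq :
    (vanishingIdeal ⟨{x}, hx⟩).comap π = vanishingIdeal ⟨π ⁻¹' ({x} : Set X), hx.preimage π.continuous⟩ :=
  hπ.comap_vanishingIdeal_eq_vanishingIdeal_preimage hX (isRegular_subscheme_vanishingIdeal_singleton hx)

include hX hπ in
/-- For the generic point `η_E` of `E`: the prime-divisor ideal `𝓘_{cl η_E}` IS the exceptional ideal `𝓘_{x}·𝒪_{X′}`.
[cite: Liu2002, Thm. 8.1.19 (b)] -/
theorem primeDivisorIdeal_excGen_eq_comap {η : X'} (hη : IsGenericPoint η (π ⁻¹' ({x} : Set X))) :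
    primeDivisorIdeal η = (vanishingIdeal ⟨{x}, hx⟩).comap π := by
  rw [comap_vanishingIdeal_singleton_eq hX hx hπ, primeDivisorIdeal]
  congr 1
  exact Closeds.ext hη

include hX hπ in
/-- **The exceptional prime divisor is a regular scheme** (with its reduced structure; Liu 8.1.19 (b), tree
`IsBlowup.isRegular_subscheme_comap`). [cite: Liu2002, Thm. 8.1.19 (b)] -/
theorem isRegular_subscheme_primeDivisorIdeal_excGen {η : X'} (hη : IsGenericPoint η (π ⁻¹' ({x} : Set X))) :
    Scheme.IsRegular (primeDivisorIdeal η).subscheme := by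
  rw [primeDivisorIdeal_excGen_eq_comap hX hx hπ hη]
  exact hπ.isRegular_subscheme_comap hX (isRegular_subscheme_vanishingIdeal_singleton hx)

omit [IsLocallyNoetherian X] in
/-- The generic point of `E` lies over `x`. [folklore] -/
theorem apply_excGen_eq {η : X'} (hη : IsGenericPoint η (π ⁻¹' ({x} : Set X))) : π η = x := by
  have h : η ∈ π ⁻¹' ({x} : Set X) := hη.mem
  exact h

include hX hxne hπ in
/-- **The exceptional prime divisor has codimension one**: the local ring `𝒪_{X′,η_E}` is a Noetherian local domain whose maximal
ideal is the stalk of the Cartier exceptional ideal, principal on a non-zero-divisor, hence a discrete valuation ring.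
[cite: Liu2002, Thm. 8.1.19 (b)] -/
theorem coheight_excGen [IsIntegral X] {η : X'} (hη : IsGenericPoint η (π ⁻¹' ({x} : Set X))) :
    Order.coheight η = 1 := by
  haveI : IsIntegral X' := hπ.isIntegral (vanishingIdeal_singleton_ne_bot hx hxne)
  haveI : IsProper π := hπ.isProper
  haveI : IsLocallyNoetherian X' := LocallyOfFiniteType.isLocallyNoetherian π
  haveI : IsNoetherianRing (X'.presheaf.stalk η) := inferInstance
  -- the maximal ideal of `𝒪_{X′,η}` is the stalk of the exceptional ideal, `= (t)` with `t` a non-zero-divisor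
  have hmax : stalkIdeal ((vanishingIdeal ⟨{x}, hx⟩).comap π) η = maximalIdeal (X'.presheaf.stalk η) := by
    rw [comap_vanishingIdeal_singleton_eq hX hx hπ]
    exact stalkIdeal_vanishingIdeal_eq_maximalIdeal_of_closure_eq hη.symm
  obtain ⟨t, ht, hspan⟩ := hπ.isEffectiveCartier.exists_stalkIdeal_eq_span η
  rw [hmax] at hspan
  have hnf : ¬ IsField (X'.presheaf.stalk η) := by
    intro hF
    have h0 : maximalIdeal (X'.presheaf.stalk η) = ⊥ := isField_iff_maximalIdeal_eq.mp hF
    rw [hspan, Ideal.span_singleton_eq_bot] at h0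
    exact nonZeroDivisors.ne_zero ht h0
  have hprinc : (maximalIdeal (X'.presheaf.stalk η)).IsPrincipal := ⟨⟨t, hspan⟩⟩
  have hDVR : IsDiscreteValuationRing (X'.presheaf.stalk η) :=
    ((IsDiscreteValuationRing.TFAE (X'.presheaf.stalk η) hnf).out 4 0).mp hprinc
  have h := ringKrullDim_stalk_eq_coheight η
  rw [IsDiscreteValuationRing.ringKrullDim_eq_one] at h
  exact_mod_cast h.symm

include hX hxne hπ in
/-- **The controlled transform loses exactly `m` along the exceptional divisor**: `ord_{η_E} J′ = ord_x J − m` (truncated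
subtraction in `ℕ∞`; tree `IsBlowup.idealOrder_controlledTransform_genericPoint_preimage`).
[cite: CossartPiltant2008, proof of Prop. 4.2, (10)–(11)] -/
theorem idealOrder_controlledTransform_excGen [IrreducibleSpace X] {η : X'}
    (hη : IsGenericPoint η (π ⁻¹' ({x} : Set X))) (J : X.IdealSheafData) (m : ℕ) :
    idealOrder (controlledTransform π (vanishingIdeal ⟨{x}, hx⟩) J m) η = idealOrder J x - m := by
  haveI : IsProper π := hπ.isProper
  haveI : IsLocallyNoetherian X' := LocallyOfFiniteType.isLocallyNoetherian π
  have h := hπ.idealOrder_controlledTransform_genericPoint_preimage (D := ⟨{x}, hx⟩) hX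
    (isRegular_subscheme_vanishingIdeal_singleton hx) isIrreducible_singleton (interior_singleton_eq_empty hx hxne) hη J m
  rwa [apply_excGen_eq hη] at h

omit [IsLocallyNoetherian X] in
/-- A point `ζ′` with `π ζ′ ≠ x` lies off the centre `V(𝓘_{x})`. [folklore] -/
theorem apply_not_mem_support_of_apply_ne {ζ' : X'} (hζ' : π ζ' ≠ x) :
    π ζ' ∉ ((vanishingIdeal (⟨{x}, hx⟩ : Closeds X)).support : Set X) := by
  rw [coe_support_vanishingIdeal]
  exact hζ'

omit [IsLocallyNoetherian X] in
include hπ in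
/-- **Off the exceptional locus the orders do not change**: `ord_{ζ′} J′ = ord_{π ζ′} J` for `π ζ′ ≠ x`.
[cite: BierstoneGrigorievMilmanWlodarczyk2011, Lemma 8.0.3 (2) with §3.2] -/
theorem idealOrder_controlledTransform_of_apply_ne {ζ' : X'} (hζ' : π ζ' ≠ x) (J : X.IdealSheafData) (m : ℕ) :
    idealOrder (controlledTransform π (vanishingIdeal ⟨{x}, hx⟩) J m) ζ' = idealOrder J (π ζ') :=
  hπ.idealOrder_controlledTransform_of_not_mem J m (apply_not_mem_support_of_apply_ne hx hζ')

omit [IsLocallyNoetherian X] in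
include hπ in
/-- Off the exceptional locus the codimension does not change (the local rings are isomorphic, Stacks 02OS).
[cite: StacksProject, Tag 02OS] -/
theorem coheight_eq_of_apply_ne {ζ' : X'} (hζ' : π ζ' ≠ x) : Order.coheight ζ' = Order.coheight (π ζ') := by
  haveI : IsIso (π.stalkMap ζ') := hπ.isIso_stalkMap_of_not_mem_support (apply_not_mem_support_of_apply_ne hx hζ')
  have h1 := ringKrullDim_stalk_eq_coheight ζ'
  have h2 := ringKrullDim_stalk_eq_coheight (π ζ')
  have h3 : ringKrullDim (X.presheaf.stalk (π ζ')) = ringKrullDim (X'.presheaf.stalk ζ') :=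
    ringKrullDim_eq_of_ringEquiv (asIso (π.stalkMap ζ')).commRingCatIsoToRingEquiv
  rw [h1, h2] at h3
  exact_mod_cast h3.symm

/-- Membership in the support through the order: `y ∈ V(K) ↔ 1 ≤ ord_y K`. [folklore] -/
theorem mem_support_iff_one_le_idealOrder {Y : Scheme.{u}} (K : Y.IdealSheafData) (y : Y) :
    y ∈ K.support ↔ (1 : ℕ∞) ≤ idealOrder K y := by
  rw [mem_support_iff_stalkIdeal_le, show (1 : ℕ∞) = ((1 : ℕ) : ℕ∞) from rfl, le_idealOrder_iff, pow_one]

omit [IsLocallyNoetherian X] in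
include hπ in
/-- **Off the exceptional locus the prime divisors of `J′` are those of `J`** (same codimension, same support):
for `π ζ′ ≠ x`, `ζ′ ∈ divisorialPoints J′ ↔ π ζ′ ∈ divisorialPoints J`. [cite: StacksProject, Tag 02OS] -/
theorem mem_divisorialPoints_controlledTransform_iff_of_ne {ζ' : X'} (hζ' : π ζ' ≠ x) (J : X.IdealSheafData) (m : ℕ) :
    ζ' ∈ divisorialPoints (controlledTransform π (vanishingIdeal ⟨{x}, hx⟩) J m) ↔ π ζ' ∈ divisorialPoints J := by
  rw [mem_divisorialPoints_iff, mem_divisorialPoints_iff, mem_support_iff_one_le_idealOrder,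
    mem_support_iff_one_le_idealOrder, idealOrder_controlledTransform_of_apply_ne hx hπ hζ' J m,
    coheight_eq_of_apply_ne hx hπ hζ']

include hX hxne hπ in
/-- **Over the centre the only possible prime divisor of `J′` is the exceptional generic point**: a point of `E` of codimension
one is `η_E` (every point of the irreducible `E` is a specialisation of `η_E`, and specialisation raises the codimension).
[cite: Liu2002, Thm. 8.1.19 (b)] -/
theorem eq_excGen_of_mem_preimage_of_coheight_eq_one [IsIntegral X] {η : X'}
    (hη : IsGenericPoint η (π ⁻¹' ({x} : Set X))) {ζ' : X'} (hζ' : π ζ' = x) (hcoh : Order.coheight ζ' = 1) :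
    ζ' = η := by
  have hsp : η ⤳ ζ' := hη.specializes hζ'
  have hcohη := coheight_excGen hX hx hxne hπ hη
  exact (eq_of_specializes_of_coheight_le hsp (by rw [hcoh]; exact ENat.coe_ne_top 1) (by rw [hcoh, hcohη])).symm

include hX hxne hπ in
/-- For `π ζ′ = x`: `ζ′ ∈ divisorialPoints J′ → ζ′ = η_E`. [cite: Liu2002, Thm. 8.1.19 (b)] -/
theorem eq_excGen_of_mem_divisorialPoints [IsIntegral X] {η : X'} (hη : IsGenericPoint η (π ⁻¹' ({x} : Set X)))
    {ζ' : X'} (hζ' : π ζ' = x) {K : X'.IdealSheafData} (hmem : ζ' ∈ divisorialPoints K) : ζ' = η :=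
  eq_excGen_of_mem_preimage_of_coheight_eq_one hX hx hxne hπ hη hζ' ((mem_divisorialPoints_iff K ζ').mp hmem).2

include hX hxne hπ in
/-- **The exceptional divisor is a prime divisor of `J′` iff `m < ord_x J`** (its generic order is `ord_x J − m`).
[cite: CossartPiltant2008, proof of Prop. 4.2, (10)–(11)] -/
theorem excGen_mem_divisorialPoints_iff [IsIntegral X] {η : X'} (hη : IsGenericPoint η (π ⁻¹' ({x} : Set X)))
    (J : X.IdealSheafData) (m : ℕ) :
    η ∈ divisorialPoints (controlledTransform π (vanishingIdeal ⟨{x}, hx⟩) J m) ↔ (m : ℕ∞) < idealOrder J x := by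
  rw [mem_divisorialPoints_iff, mem_support_iff_one_le_idealOrder,
    idealOrder_controlledTransform_excGen hX hx hxne hπ hη J m, and_iff_left (coheight_excGen hX hx hxne hπ hη)]
  -- `1 ≤ a - m ↔ m < a` in `ℕ∞`
  have key : ∀ a : ℕ∞, (1 : ℕ∞) ≤ a - (m : ℕ∞) ↔ (m : ℕ∞) < a := by
    intro a
    induction a using ENat.recTopCoe with
    | top => simp
    | coe a =>
      rw [← ENat.coe_sub, show (1 : ℕ∞) = ((1 : ℕ) : ℕ∞) from rfl, ENat.coe_le_coe, ENat.coe_lt_coe]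
      omega
  exact key _

omit [IsLocallyNoetherian X] in
include hπ in
/-- **`π` is surjective onto `X ∖ {x}`** (an isomorphism over the complement of the centre, Stacks 02OS).
[cite: StacksProject, Tag 02OS] -/
theorem exists_eq_of_ne_centre {ζ : X} (hζ : ζ ≠ x) : ∃ ζ' : X', π ζ' = ζ := by
  set W : X.Opens := ⟨((vanishingIdeal (⟨{x}, hx⟩ : Closeds X)).support : Set X)ᶜ,
    (vanishingIdeal (⟨{x}, hx⟩ : Closeds X)).support.isClosed.isOpen_compl⟩ with hW
  haveI : IsIso (π ∣_ W) := hπ.isIso_compl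
  have hζW : ζ ∈ W := by
    change ζ ∈ ((vanishingIdeal (⟨{x}, hx⟩ : Closeds X)).support : Set X)ᶜ
    rw [coe_support_vanishingIdeal]
    exact hζ
  obtain ⟨z, hz⟩ := (asIso (π ∣_ W)).hom.homeomorph.surjective ⟨ζ, hζW⟩
  refine ⟨(π ⁻¹ᵁ W).ι z, ?_⟩
  have := congrArg (fun t : W => (t : X)) hz
  simpa [morphismRestrict_base_coe] using this

omit [IsLocallyNoetherian X] in
include hπ in
/-- **`π` is injective over `X ∖ {x}`**. [cite: StacksProject, Tag 02OS] -/
theorem eq_of_apply_eq_of_ne_centre {ζ₁ ζ₂ : X'} (h₁ : π ζ₁ ≠ x) (h : π ζ₁ = π ζ₂) : ζ₁ = ζ₂ := by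
  set W : X.Opens := ⟨((vanishingIdeal (⟨{x}, hx⟩ : Closeds X)).support : Set X)ᶜ,
    (vanishingIdeal (⟨{x}, hx⟩ : Closeds X)).support.isClosed.isOpen_compl⟩ with hW
  haveI : IsIso (π ∣_ W) := hπ.isIso_compl
  have hmem : ∀ {ζ' : X'}, π ζ' ≠ x → ζ' ∈ π ⁻¹ᵁ W := fun {ζ'} hζ' => by
    change π ζ' ∈ ((vanishingIdeal (⟨{x}, hx⟩ : Closeds X)).support : Set X)ᶜ
    rw [coe_support_vanishingIdeal]
    exact hζ'
  have h₂ : π ζ₂ ≠ x := h ▸ h₁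
  have hinj := (asIso (π ∣_ W)).hom.homeomorph.injective
  have key : (⟨ζ₁, hmem h₁⟩ : ↥(π ⁻¹ᵁ W)) = ⟨ζ₂, hmem h₂⟩ := by
    apply hinj
    apply Subtype.ext
    simpa [morphismRestrict_base_coe] using h
  exact congrArg Subtype.val key

end PointBlowup

end CampaignW46

end Summit.ResolutionOfSingularities.ResolutionOfSingularities.Theorems

end
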